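import Literature.Algebra.EuclideanLattices.SmoothingParameterProofs
import Literature.Algebra.EuclideanLattices.IntegerBases
import HarnessLib

/-!
# A lower bound for the smoothing parameter of integer lattices: `η_ε(Λ) ≥ √(ln(2/ε)/π)` for `Λ ⊆ ℤⁿ`

Topic `Algebra/EuclideanLattices` (family `pqc`). Micciancio–Regev 2007, §3 (Def. 3.1): the smoothing
parameter `η_ε(Λ) = inf {s > 0 | ρ_{1/s}(Λ* ∖ {0}) ≤ ε}`. For a sublattice `Λ` of `ℤⁿ` (`n ≥ 1`) the dual
contains `±e₁`, so `ρ_{1/s}(Λ* ∖ {0}) ≥ 2e^{−πs²}`, which exceeds `ε` as long as `s < √(ln(2/ε)/π)`; hence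
**`η_ε(Λ) ≥ √(ln(2/ε)/π)`** (`le_smoothingParameter_of_le_stdIntLattice`), in particular
`η_{2⁻ⁿ}(Λ) ≥ √((n+1) ln 2/π)`. Written for the machine-level MR07 Thm. 5.23, where the integral scaled dual
`Λ = det(B)²·L(B)*` is such a lattice and the loop of Lemma 5.10 stops with `‖S‖ ≤ 8γη + O(1)`, which this bound
turns into `‖S‖ ≤ (8 + o(1)) γ η`. Theorems only; no named fact.

## References

* D. Micciancio, O. Regev, *Worst-case to average-case reductions based on Gaussian measures*,
  SIAM J. Comput. 37 (2007) 267–302; authors' version, Def. 3.1 and the remark after it (p. 11), Lemma 3.2.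
-/

noncomputable section

open scoped Real ENNReal InnerProductSpace

namespace Literature.Algebra.EuclideanLattices

open Module Submodule

/-- **The first coordinate vector pairs integrally with `ℤⁿ`**, hence lies in the dual of every `Λ ⊆ ℤⁿ`. [cite: MicciancioRegev2007, §2 (the dual lattice)] -/
theorem single_mem_dualLattice_of_le_stdIntLattice {n : ℕ} (i : Fin n) (Λ : Submodule ℤ (EuclideanSpace ℝ (Fin n)))
    (hΛ : Λ ≤ stdIntLattice n) : EuclideanSpace.single i (1 : ℝ) ∈ dualLattice Λ := by
  rw [mem_dualLattice]
  intro v hv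
  obtain ⟨k, hk⟩ := (mem_stdIntLattice_iff v).1 (hΛ hv) i
  refine ⟨k, ?_⟩
  rw [EuclideanSpace.inner_single_left, map_one, one_mul, hk]

/-- **`ρ_{1/s}(Λ* ∖ {0}) ≥ 2e^{−πs²}` for `Λ ⊆ ℤⁿ`, `n ≥ 1`** (the two dual vectors `±e₁`).
[cite: MicciancioRegev2007, §3 (remark after Def. 3.1)] -/
theorem two_mul_exp_le_gaussianMass_dual {n : ℕ} (hn : 1 ≤ n) (Λ : Submodule ℤ (EuclideanSpace ℝ (Fin n)))
    (hΛ : Λ ≤ stdIntLattice n) (s : ℝ) :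
    ENNReal.ofReal (2 * Real.exp (-π * s ^ 2)) ≤
      gaussianMass (1 / s) 0 ((dualLattice Λ : Set (EuclideanSpace ℝ (Fin n))) \ {0}) := by
  set e : EuclideanSpace ℝ (Fin n) := EuclideanSpace.single ⟨0, hn⟩ (1 : ℝ) with he
  have hnorm : ‖e‖ = 1 := by rw [he, EuclideanSpace.single, PiLp.norm_single, norm_one]
  have he0 : e ≠ 0 := fun h => by rw [h, norm_zero] at hnorm; exact zero_ne_one hnorm
  have hmem : e ∈ dualLattice Λ := single_mem_dualLattice_of_le_stdIntLattice ⟨0, hn⟩ Λ hΛ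
  set A : Set (EuclideanSpace ℝ (Fin n)) := (dualLattice Λ : Set (EuclideanSpace ℝ (Fin n))) \ {0} with hA
  have heA : e ∈ A := ⟨hmem, he0⟩
  have hneA : -e ∈ A := ⟨neg_mem hmem, neg_ne_zero.2 he0⟩
  have hne : (⟨e, heA⟩ : A) ≠ ⟨-e, hneA⟩ := fun h => by
    have h' : e = -e := congrArg Subtype.val h
    have : (2 : ℝ) • e = 0 := by rw [two_smul]; nth_rewrite 2 [h']; exact add_neg_cancel e
    exact he0 (by simpa using this)
  have hval : ∀ x ∈ ({⟨e, heA⟩, ⟨-e, hneA⟩} : Finset A), ENNReal.ofReal (gaussianFunction (1 / s) ((x : EuclideanSpace ℝ (Fin n)) - 0)) =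
      ENNReal.ofReal (Real.exp (-π * s ^ 2)) := by
    intro x hx
    rw [Finset.mem_insert, Finset.mem_singleton] at hx
    rcases hx with rfl | rfl
    · simp only [sub_zero, gaussianFunction_one_div, hnorm, one_pow, mul_one]
    · simp only [sub_zero, gaussianFunction_one_div, norm_neg, hnorm, one_pow, mul_one]
  calc ENNReal.ofReal (2 * Real.exp (-π * s ^ 2))
      = ENNReal.ofReal (Real.exp (-π * s ^ 2)) + ENNReal.ofReal (Real.exp (-π * s ^ 2)) := by
        rw [two_mul, ENNReal.ofReal_add (Real.exp_pos _).le (Real.exp_pos _).le]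
    _ = ∑ x ∈ ({⟨e, heA⟩, ⟨-e, hneA⟩} : Finset A), ENNReal.ofReal (gaussianFunction (1 / s) ((x : EuclideanSpace ℝ (Fin n)) - 0)) := by
        rw [Finset.sum_pair hne, hval _ (by simp), hval _ (by simp)]
    _ ≤ gaussianMass (1 / s) 0 A := ENNReal.sum_le_tsum _

/-- **`η_ε(Λ) ≥ √(ln(2/ε)/π)` for every full-rank `Λ ⊆ ℤⁿ`** (`n ≥ 1`, `0 < ε < 2`): below that value of `s`
the two dual vectors `±e₁` alone carry Gaussian mass `2e^{−πs²} > ε`.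
[cite: MicciancioRegev2007, Def. 3.1 (p. 11) — elementary lower bound] -/
theorem le_smoothingParameter_of_le_stdIntLattice {n : ℕ} (hn : 1 ≤ n) (Λ : Submodule ℤ (EuclideanSpace ℝ (Fin n)))
    [DiscreteTopology Λ] [IsZLattice ℝ Λ] (hΛ : Λ ≤ stdIntLattice n) {ε : ℝ} (hε : 0 < ε) (hε2 : ε < 2) :
    Real.sqrt (Real.log (2 / ε) / π) ≤ smoothingParameter Λ ε := by
  set t : ℝ := Real.sqrt (Real.log (2 / ε) / π) with ht
  have hlog : 0 < Real.log (2 / ε) := Real.log_pos (by rw [lt_div_iff₀ hε]; linarith)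
  refine le_of_not_gt fun hlt => ?_
  obtain ⟨s, hηs, hst⟩ := exists_between hlt
  have hs0 : 0 < s := lt_of_le_of_lt (smoothingParameter_nonneg Λ ε) hηs
  -- above `η_ε`: the dual mass is at most `ε`
  have hmass := gaussianMass_dual_le_of_smoothingParameter_le Λ hε hηs.le
  -- but `s < t` gives `2e^{−πs²} > ε`
  have hexp : ε < 2 * Real.exp (-π * s ^ 2) := by
    have hs2 : π * s ^ 2 < Real.log (2 / ε) := by
      have h1 : s ^ 2 < t ^ 2 := by
        have ht0 : 0 ≤ t := by rw [ht]; exact Real.sqrt_nonneg _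
        nlinarith
      rw [ht, Real.sq_sqrt (div_nonneg hlog.le Real.pi_pos.le)] at h1
      have := mul_lt_mul_of_pos_left h1 Real.pi_pos
      rwa [mul_div_cancel₀ _ Real.pi_pos.ne'] at this
    have h2 : ε / 2 < Real.exp (-π * s ^ 2) := by
      rw [← Real.exp_log (half_pos hε), Real.exp_lt_exp]
      have : Real.log (ε / 2) = -Real.log (2 / ε) := by
        rw [← Real.log_inv]; congr 1; rw [inv_div]
      rw [this]; linarith
    linarith
  have hlt' : ENNReal.ofReal ε < ENNReal.ofReal (2 * Real.exp (-π * s ^ 2)) := (ENNReal.ofReal_lt_ofReal_iff (by positivity)).2 hexp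
  exact absurd (hmass.trans_lt hlt') (not_lt.2 (two_mul_exp_le_gaussianMass_dual hn Λ hΛ s))

/-- **`η_{2⁻ⁿ}(Λ) ≥ √((n + 1) ln 2/π)`** for a full-rank `Λ ⊆ ℤⁿ`, `n ≥ 1`. [cite: MicciancioRegev2007, Def. 3.1 (p. 11) — elementary lower bound] -/
theorem sqrt_le_smoothingParameter_two_inv_pow {n : ℕ} (hn : 1 ≤ n) (Λ : Submodule ℤ (EuclideanSpace ℝ (Fin n)))
    [DiscreteTopology Λ] [IsZLattice ℝ Λ] (hΛ : Λ ≤ stdIntLattice n) :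
    Real.sqrt ((n + 1) * Real.log 2 / π) ≤ smoothingParameter Λ ((2⁻¹ : ℝ) ^ n) := by
  have h := le_smoothingParameter_of_le_stdIntLattice hn Λ hΛ (ε := (2⁻¹ : ℝ) ^ n) (by positivity)
    (by calc (2⁻¹ : ℝ) ^ n ≤ 1 := pow_le_one₀ (by norm_num) (by norm_num)
          _ < 2 := by norm_num)
  have hlog : Real.log (2 / (2⁻¹ : ℝ) ^ n) = (n + 1) * Real.log 2 := by
    rw [inv_pow, div_inv_eq_mul, ← pow_succ', Real.log_pow]; push_cast; ring
  rwa [hlog] at h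

end Literature.Algebra.EuclideanLattices

end
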